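import Summits.CriticalPhenomena.CardyFormulaZ2.Theorems.CardyBoundaryCoulombGasRectilinearCardyStubEventIdentityPart4

/-!
# Stub `stub_eventIdentity` of line `excursion-kernel-covariance` (crux `RectilinearCardy`,
# stmt-CriticalPhenomena-5660) — Part 5: a wired stretch is joined by open edges of the completed
# configuration (layer L6 of the design `Lines/excursion-kernel-covariance-eventIdentity-design.md`)

For a general collar leg model `M` on `V`, `ω ⊆ M.E`, `β = M.cfgOf ω` and the boundary walk `dsucc V`:

* `ei_adj_of_mem_cfgOf` — a live-open or frozen open coded edge is an open lattice edge of `β`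
  (adjacency in `openGraph β ⊓ zdGraph 2`); `ei_reachable_spoke` — an arc vertex is joined to its
  ghost by the spoke;
* `ei_pocketEdge_of_straight` — the far edge of the gap face after `(v, k)`, joining the ghost
  `v + dir k` to `v + dir k + dir (k+1)`, is an edge of that face (explicit coded edge, four cases);
* `ei_reachable_dsucc_wired` — **one step of a wired stretch**: if the exterior dart `d` and its
  successor sit at arc vertices and the gap face after `d` is a pocket, the two vertices are joined by
  open edges of `β` — the same vertex at a convex turn, two spokes through the shared ghost at a reflex
  turn, spoke + pocket edge + spoke along a straight step (`tc_spoke_open`, `tc_pocketEdge_open`);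
* `ei_reachable_of_wired_stretch` — hence all vertices of a stretch `e i = (dsucc V)^[i] d₀`,
  `a ≤ i ≤ b`, of arc vertices whose gap faces (before the last) are pockets, are joined by open edges
  of `β`: a wired arc is ONE cluster of the completed configuration, whatever `ω`.

All [folklore]; no new objects.
-/

namespace Summit.CriticalPhenomena.CardyFormulaZ2.Cruxes.RectilinearCardy.ExcursionKernelCovariance

open Finset Literature.Probability.LatticeModels Literature.Probability.LatticeModels.CollarLegModel
open Summit.CriticalPhenomena.CardyFormulaZ2.Cruxes.BoundaryDefectGaussianR.RainbowMonomialsInExcursionKernels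
open Literature.Probability.Percolation (openGraph openGraph_adj)

section Wired

variable {M : CollarLegModel} {ω : Finset ((ℤ × ℤ) × Bool)}

/-- **An edge of the completed configuration is an open lattice edge**: for a coded edge `e` that is
live-open (`e ∈ ω`) or frozen open, its endpoints are adjacent in `openGraph (M.cfgOf ω) ⊓ zdGraph 2`.
[folklore] -/
theorem ei_adj_of_mem_cfgOf {e : (ℤ × ℤ) × Bool} (he : e ∈ ω ∨ e ∈ M.openEdges) :
    (openGraph (M.cfgOf ω) ⊓ zdGraph 2).Adj (toSite e.1) (toSite (SixVertex.edgeTip e)) := by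
  have hmem : edgeSym2 e ∈ M.cfgOf ω := (M.edgeSym2_mem_cfgOf_iff ω e).2 he
  have hlat : (zdGraph 2).Adj (toSite e.1) (toSite (SixVertex.edgeTip e)) := by
    rw [← SimpleGraph.mem_edgeSet]
    have := cTgt_mem_edgeSet (cIn e)
    rwa [cTgt_cIn, edgeSym2] at this
  rw [SimpleGraph.inf_adj, openGraph_adj]
  exact ⟨⟨by rwa [edgeSym2] at hmem, hlat.ne⟩, hlat⟩

/-- **An arc vertex is joined to its ghost by the spoke.** [folklore] -/
theorem ei_reachable_spoke {v : ℤ × ℤ} {K : Fin 4} (hv : v ∈ M.arcVerts) (hg : v + dir K ∉ M.V) :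
    (openGraph (M.cfgOf ω) ⊓ zdGraph 2).Reachable (toSite v) (toSite (v + dir K)) := by
  obtain ⟨e, -, hend⟩ := se_corner_edge v (K + 3)
  have hK : K + 3 + 1 = K := by fin_cases K <;> rfl
  rw [hK] at hend
  have hopen := (tc_spoke_open M hv hg hend).2
  have hadj := ei_adj_of_mem_cfgOf (ω := ω) (Or.inr hopen)
  rcases hend with ⟨h1, h2⟩ | ⟨h1, h2⟩
  · rw [h1, h2] at hadj; exact hadj.reachable
  · rw [h1, h2] at hadj; exact hadj.symm.reachable

/-- **The far edge of the gap face after a straight dart.** For the exterior dart `(v, k)`, the coded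
edge joining `v + dir k` and `v + dir k + dir (k+1)` is an edge of `gapFace (v, k)`. [folklore] -/
theorem ei_pocketEdge_of_straight (v : ℤ × ℤ) (k : Fin 4) : ∃ e : (ℤ × ℤ) × Bool, e ∈ faceEdges (gapFace (v, k)) ∧
    ((e.1 = v + dir k ∧ SixVertex.edgeTip e = v + dir k + dir (k + 1)) ∨
      (e.1 = v + dir k + dir (k + 1) ∧ SixVertex.edgeTip e = v + dir k)) := by
  obtain ⟨p, q⟩ := v
  fin_cases k
  · exact ⟨((p + 1, q), true), by simp [faceEdges, gapFace], Or.inl ⟨by simp [tp_dir_val], by simp [SixVertex.edgeTip, tp_dir_val]⟩⟩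
  · refine ⟨((p - 1, q + 1), false), by simp [faceEdges, gapFace], Or.inr ⟨?_, ?_⟩⟩
    · simp [tp_dir_val]; ring
    · simp [SixVertex.edgeTip, tp_dir_val]
  · refine ⟨((p - 1, q - 1), true), by simp [faceEdges, gapFace], Or.inr ⟨?_, ?_⟩⟩
    · simp [tp_dir_val]; constructor <;> ring
    · simp [SixVertex.edgeTip, tp_dir_val]; ring
  · refine ⟨((p, q - 1), false), by simp [faceEdges, gapFace], Or.inl ⟨?_, ?_⟩⟩
    · simp [tp_dir_val]; ring
    · simp [SixVertex.edgeTip, tp_dir_val]; ring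

/-- **One step of a wired stretch is joined by open edges of the completed configuration.** Let `d`
be an exterior dart of `M.V` such that `d.1` and the vertex of `dsucc V d` are arc vertices and the
gap face after `d` is a pocket. Then the two vertices are joined in `openGraph (M.cfgOf ω) ⊓ zdGraph 2`:
at a convex turn they coincide; at a reflex turn the common ghost `d.1 + dir d.2` is joined to both by
spokes; along a straight step the two ghosts are joined by the far pocket edge and to their arc
vertices by spokes. [folklore] -/
theorem ei_reachable_dsucc_wired {d : Dart} (hd1 : d.1 ∈ M.V) (hd2 : dartTip d ∉ M.V)
    (harc : d.1 ∈ M.arcVerts) (harc' : (dsucc M.V d).1 ∈ M.arcVerts) (hpk : gapFace d ∈ M.pockets) :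
    (openGraph (M.cfgOf ω) ⊓ zdGraph 2).Reachable (toSite d.1) (toSite (dsucc M.V d).1) := by
  obtain ⟨v, k⟩ := d
  simp only [dartTip] at hd1 hd2 harc hpk ⊢
  have n3 : dir (k + 3) = -dir (k + 1) := by fin_cases k <;> decide
  by_cases hA : v + dir (k + 1) ∈ M.V
  · by_cases hB : v + dir (k + 1) + dir k ∈ M.V
    · -- reflex turn: successor `(v + dir (k+1) + dir k, k + 3)`, shared ghost `v + dir k`
      have hds : dsucc M.V (v, k) = (v + dir (k + 1) + dir k, k + 3) := by simp [dsucc, hA, hB]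
      rw [hds] at harc' ⊢
      simp only at harc' ⊢
      have hg' : v + dir (k + 1) + dir k + dir (k + 3) = v + dir k := by rw [n3]; abel
      have h1 := ei_reachable_spoke (ω := ω) harc hd2
      have h2 := ei_reachable_spoke (ω := ω) (K := k + 3) harc' (by rw [hg']; exact hd2)
      rw [hg'] at h2
      exact h1.trans h2.symm
    · -- straight step: successor `(v + dir (k+1), k)`
      have hds : dsucc M.V (v, k) = (v + dir (k + 1), k) := by simp [dsucc, hA, hB]
      rw [hds] at harc' ⊢
      simp only at harc' ⊢
      have hg2 : v + dir (k + 1) + dir k = v + dir k + dir (k + 1) := by abel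
      -- spokes at both ends
      have h1 := ei_reachable_spoke (ω := ω) harc hd2
      have h3 := ei_reachable_spoke (ω := ω) harc' hB
      -- the far pocket edge between the two ghosts
      obtain ⟨e, he, hend⟩ := ei_pocketEdge_of_straight v k
      have hghost : v + dir k ∈ M.ghosts := by
        obtain ⟨e', -, hend'⟩ := se_corner_edge v (k + 3)
        have hK : k + 3 + 1 = k := by fin_cases k <;> rfl
        rw [hK] at hend'
        exact (tc_spoke_open M harc hd2 hend').1
      have hcell : v + dir k ∈ M.vertexCells := Finset.mem_union_right _ hghost
      have hB' : v + dir k + dir (k + 1) ∉ M.V := by rwa [← hg2]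
      have hopen : e ∈ M.openEdges := by
        rcases hend with ⟨ha, hb⟩ | ⟨ha, hb⟩
        · exact tc_pocketEdge_open M hpk he (ha ▸ hd2) (hb ▸ hB') (Or.inl (ha ▸ hcell))
        · exact tc_pocketEdge_open M hpk he (ha ▸ hB') (hb ▸ hd2) (Or.inr (hb ▸ hcell))
      have h2 : (openGraph (M.cfgOf ω) ⊓ zdGraph 2).Reachable (toSite (v + dir k)) (toSite (v + dir k + dir (k + 1))) := by
        have hadj := ei_adj_of_mem_cfgOf (ω := ω) (Or.inr hopen)
        rcases hend with ⟨ha, hb⟩ | ⟨ha, hb⟩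
        · rw [ha, hb] at hadj; exact hadj.reachable
        · rw [ha, hb] at hadj; exact hadj.symm.reachable
      rw [hg2] at h3
      exact (h1.trans h2).trans h3.symm
  · -- convex turn: successor `(v, k + 1)`, same vertex
    have hds : dsucc M.V (v, k) = (v, k + 1) := by simp [dsucc, hA]
    rw [hds]

/-- **A wired stretch is one cluster of the completed configuration.** Along the walk
`e i = (dsucc V)^[i] d₀` of exterior darts of `M.V`: if all `e i`, `a ≤ i ≤ b`, sit at arc vertices and
the gap faces of `e i`, `a ≤ i < b`, are pockets, then the vertices of `e a` and `e b` are joined by open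
lattice edges of `M.cfgOf ω`. [folklore] -/
theorem ei_reachable_of_wired_stretch {M : CollarLegModel} {ω : Finset ((ℤ × ℤ) × Bool)}
    {d₀ : Dart} (hd₀ : d₀.1 ∈ M.V) (hd₀' : dartTip d₀ ∉ M.V) {a b : ℕ} (hab : a ≤ b)
    (harc : ∀ i, a ≤ i → i ≤ b → ((dsucc M.V)^[i] d₀).1 ∈ M.arcVerts)
    (hpk : ∀ i, a ≤ i → i < b → gapFace ((dsucc M.V)^[i] d₀) ∈ M.pockets) :
    (openGraph (M.cfgOf ω) ⊓ zdGraph 2).Reachable (toSite ((dsucc M.V)^[a] d₀).1)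
      (toSite ((dsucc M.V)^[b] d₀).1) := by
  induction b, hab using Nat.le_induction with
  | base => exact SimpleGraph.Reachable.refl _
  | succ b hab ih =>
    refine (ih (fun i hi hib => harc i hi (Nat.le_succ_of_le hib)) fun i hi hib => hpk i hi (Nat.lt_succ_of_lt hib)).trans ?_
    have hext : ∀ i, ((dsucc M.V)^[i] d₀).1 ∈ M.V ∧ dartTip ((dsucc M.V)^[i] d₀) ∉ M.V :=
      fun i => (s3_dsucc_iterate M.V i).1 d₀ hd₀ hd₀'
    rw [Function.iterate_succ_apply']
    exact ei_reachable_dsucc_wired (hext b).1 (hext b).2 (harc b hab (Nat.le_succ b))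
      (by rw [← Function.iterate_succ_apply' (dsucc M.V)]; exact harc (b + 1) (Nat.le_succ_of_le hab) le_rfl)
      (hpk b hab (Nat.lt_succ_self b))

end Wired

end Summit.CriticalPhenomena.CardyFormulaZ2.Cruxes.RectilinearCardy.ExcursionKernelCovariance
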